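import Summits.NavierStokesRegularity.FluidComputer.SoftExtrema
import Summits.NavierStokesRegularity.FluidComputer.SoftExtremaFinset

/-!
# Soft extrema: the two-level soft minimum is the `k = 2` case of the `k`-level one

Cell `pub-fluidc` (FLUID COMPUTER; host summit `NavierStokesRegularity`), prover seat p1 (gen 6 draft, filed gen 8).
HONEST FRAMING: low prior, high value-of-information experiment on Tao's machine paradigm; NOT a claim that NS blows
up. One identification linking `FluidComputer.SoftExtrema.softMin` (the registered two-level relay surrogate
`PM₋q(r₁, r₂)`, RULING R44 (ii)(b)) and `FluidComputer.SoftExtrema.softMinN` (a finite family of level ratios,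
`SoftExtremaFinset`), kept out of both files so that each verifies independently of the other's build, plus the one
payoff the cell uses: the POWER-MEAN MONOTONICITY IN THE ORDER `q`, proved once for `softMinN` (`softMinN_anti`),
transfers to the two-level surrogate (`softMin_anti`) — a sharper (larger-`q`) surrogate never reads higher, so an
ascent's reported `J = softMin q r₁ r₂` at the registered `q = 12` is bracketed by its values at any smaller order
from above and by `min(r₁, r₂)` from below (`SoftExtrema.min_le_softMin`). 0 sorry; no named fact introduced.
-/

noncomputable section

namespace Summit.NavierStokesRegularity.FluidComputer.SoftExtrema

/-- Consistency of the two files: on two levels `softMinN` IS `softMin`, `softMinN q univ ![a, b] = softMin q a b`. -/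
theorem softMinN_pair (q a b : ℝ) : softMinN q Finset.univ ![a, b] = softMin q a b := by
  simp only [softMinN, softMin, Fin.sum_univ_two, Matrix.cons_val_zero, Matrix.cons_val_one,
    Finset.card_univ, Fintype.card_fin]
  norm_num

/-- PAYOFF: the two-level surrogate is antitone in its order, `0 < q ≤ q' ⟹ softMin q' a b ≤ softMin q a b`
(`a, b > 0`) — the `k = 2` instance of `softMinN_anti` through `softMinN_pair`. -/
theorem softMin_anti {q q' a b : ℝ} (hq : 0 < q) (hqq' : q ≤ q') (ha : 0 < a) (hb : 0 < b) :
    softMin q' a b ≤ softMin q a b := by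
  rw [← softMinN_pair, ← softMinN_pair]
  refine softMinN_anti hq hqq' Finset.univ_nonempty ?_
  intro i _
  fin_cases i <;> simp [ha, hb]

/-- Hence the registered `q = 12` reading sits between the true weakest level and every lower-order reading:
`min a b ≤ softMin 12 a b ≤ softMin q a b` for `0 < q ≤ 12`. -/
theorem softMin_twelve_mem_Icc {q a b : ℝ} (hq : 0 < q) (hq12 : q ≤ 12) (ha : 0 < a) (hb : 0 < b) :
    softMin 12 a b ∈ Set.Icc (min a b) (softMin q a b) :=
  ⟨min_le_softMin (by norm_num) ha hb, softMin_anti hq hq12 ha hb⟩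

end Summit.NavierStokesRegularity.FluidComputer.SoftExtrema

end
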